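import Literature.NumberTheory.Automorphic.Liu2021.Def411WeilCarriers
import Literature.NumberTheory.GaloisRepresentations.HeckeCharacterMuAlgGalConjTwist
import HarnessLib

/-!
# `χ̌` — the Hecke character `χ̌(x) = χ(x_f / x_fᶜ)` of `E` attached to an automorphic character `χ` of `U(1)(F)\U(1)(𝔸_{F,f})`

[Liu2021, App. D §D.1 (l. 5224): «we define a character `χ̌` … via the formula `χ̌(x) = χ(x/xᶜ)`»; Lemma D.1 (4) (l. 5235);
the global `χ̌` (a Hecke character of `E`) is the one of Thm. D.6 (l. 5441) and its proof (l. 5624, 5630)].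
Setting: `E/F` a quadratic extension of number fields with non-trivial automorphism `c` (`hcc : c * c = 1`), `U(1)(𝔸_{F,f}) =
finAdelicOne F E c` the norm-one finite idèles of `E`, `χ : Chi F E c` a continuous character of `U(1)(𝔸_{F,f})` trivial on the
rational norm-one elements (`IsAutomorphicOneChar`, ★ `Def411WeilCarriers`).

* `idelicFinPart E : 𝕀_E →* (𝔸_E^∞)ˣ` — the finite part `x ↦ x_f`;
* `finAdelicCheck F E c hcc : (𝔸_E^∞)ˣ →* finAdelicOne F E c` — `u ↦ u / uᶜ`;
* `HeckeCharacter.checkOfChi hcc χ : HeckeCharacter E` — `χ̌ := χ ∘ finAdelicCheck ∘ idelicFinPart`, trivial on `Eˣ` because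
  `(k)_f/(k)_fᶜ` is the diagonal image of the rational norm-one element `k/kᶜ`;
* API: `checkOfChi_apply`, `checkOfChi_infiniteIdeles` (`χ̌_∞ = 1`), `hasInfinityType_zero_checkOfChi` (infinity type `(0,0)`),
  `checkOfChi_localUnits` / `localComponent_checkOfChi_apply` (`χ̌_w(u) = χ(single_w(u)/single_w(u)ᶜ)`), `checkOfChi_one`,
  `checkOfChi_apply_mul`.

The local bookkeeping `χ̌_w(ϖ_w)` at a place `w` of `E` split over `F` (compatibility with the local `S.check χ` of
★ `LemD1AsPrinted`) is deliberately left to the S4 typing file (TODO(valueAtUniformizer_checkOfChi)): it needs the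
`localUnits`/`finiteAdeleSingle` dictionary at the pair `{w, wᶜ}`, not the global character.
-/

noncomputable section

open NumberField IsDedekindDomain
open scoped Topology

namespace Literature.NumberTheory.Automorphic.Liu2021

open Literature.NumberTheory.GaloisRepresentations
open Literature.NumberTheory.Automorphic.UnitaryGroup
open Literature.NumberTheory.Automorphic.Liu2021.Def411WeilCarriers

variable (F E : Type) [Field F] [Field E] [NumberField E] [Algebra F E] (c : E ≃ₐ[F] E)

/-- The FINITE PART `x_f ∈ (𝔸_E^∞)ˣ` of an idèle `x ∈ 𝕀_E = (E_∞ × 𝔸_E^∞)ˣ` (projection on the second factor).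
[cite: Liu2021, App. D §D.1 (l. 5224)] -/
def idelicFinPart : ideleGroup E →* (FiniteAdeleRing (𝓞 E) E)ˣ :=
  Units.map (MonoidHom.snd (InfiniteAdeleRing E) (FiniteAdeleRing (𝓞 E) E))

/-- `(x_f)` of `idelicFinPart` is the second component (definitional). [cite: Liu2021, App. D §D.1 (l. 5224)] -/
@[simp] theorem coe_idelicFinPart (x : ideleGroup E) :
    ((idelicFinPart E x : (FiniteAdeleRing (𝓞 E) E)ˣ) : FiniteAdeleRing (𝓞 E) E) = (x : AdeleRing (𝓞 E) E).2 := rfl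

/-- `x ↦ x_f` is continuous (a coordinate projection of the idèle group). [cite: Liu2021, App. D §D.1 (l. 5224)] -/
theorem continuous_idelicFinPart : Continuous (idelicFinPart E) :=
  Continuous.units_map _ continuous_snd

/-- **`u ↦ u / uᶜ` lands in the norm-one finite idèles** `U(1)(𝔸_{F,f}) = finAdelicOne F E c` when `c` is an involution
(`(u/uᶜ)ᶜ · (u/uᶜ) = uᶜ u⁻¹ u (uᶜ)⁻¹ = 1`), as a group homomorphism `(𝔸_E^∞)ˣ → U(1)(𝔸_{F,f})`.
[cite: Liu2021, App. D §D.1 (l. 5224)] -/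
def finAdelicCheck (hcc : c * c = 1) : (FiniteAdeleRing (𝓞 E) E)ˣ →* finAdelicOne F E c :=
  MonoidHom.codRestrict
    ((MonoidHom.id (FiniteAdeleRing (𝓞 E) E)ˣ) / Units.map (conjFiniteAdele F E c).toMonoidHom)
    (finAdelicOne F E c) fun u => by
      rw [mem_finAdelicOne_iff]
      have hcU : Units.map (conjFiniteAdele F E c).toMonoidHom (Units.map (conjFiniteAdele F E c).toMonoidHom u) = u :=
        Units.ext (by
          change conjFiniteAdele F E c (conjFiniteAdele F E c (u : FiniteAdeleRing (𝓞 E) E)) = u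
          rw [conjFiniteAdele_apply, conjFiniteAdele_apply, ← mul_smul, hcc, one_smul])
      have hv : conjFiniteAdele F E c
          ((((MonoidHom.id (FiniteAdeleRing (𝓞 E) E)ˣ) / Units.map (conjFiniteAdele F E c).toMonoidHom) u :
            (FiniteAdeleRing (𝓞 E) E)ˣ) : FiniteAdeleRing (𝓞 E) E) =
          ((Units.map (conjFiniteAdele F E c).toMonoidHom
            (((MonoidHom.id (FiniteAdeleRing (𝓞 E) E)ˣ) / Units.map (conjFiniteAdele F E c).toMonoidHom) u) :
              (FiniteAdeleRing (𝓞 E) E)ˣ) : FiniteAdeleRing (𝓞 E) E) := rfl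
      rw [hv, ← Units.val_mul, MonoidHom.div_apply, MonoidHom.id_apply, map_div, hcU, div_mul_div_cancel, div_self',
        Units.val_one]

/-- underlying finite idèle of `finAdelicCheck u`: `u / uᶜ`. [cite: Liu2021, App. D §D.1 (l. 5224)] -/
@[simp] theorem coe_finAdelicCheck (hcc : c * c = 1) (u : (FiniteAdeleRing (𝓞 E) E)ˣ) :
    ((finAdelicCheck F E c hcc u : finAdelicOne F E c) : (FiniteAdeleRing (𝓞 E) E)ˣ) =
      u / Units.map (conjFiniteAdele F E c).toMonoidHom u := rfl

/-- `u ↦ u / uᶜ` is continuous (`c` acts continuously on `𝔸_E^∞`, `continuous_conjFiniteAdele`). [cite: Liu2021, App. D §D.1 (l. 5224)] -/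
theorem continuous_finAdelicCheck (hcc : c * c = 1) : Continuous (finAdelicCheck F E c hcc) := by
  refine Continuous.subtype_mk ?_ _
  exact continuous_id.div' (Continuous.units_map _ (continuous_conjFiniteAdele F E c))

variable {F E c}

/-- **`χ̌` — the Hecke character of `E` attached to an automorphic character `χ` of `E¹\(𝔸_E^∞)¹`** ([Liu2021] App. D §D.1,
l. 5224: «`χ̌(x) = χ(x/xᶜ)`»; Lem. D.1 (4), l. 5235; the global `χ̌` of Thm. D.6, l. 5441): `χ̌(x) := χ(x_f / x_fᶜ)` for `x ∈ 𝕀_E`, `x_f` its finite part, `c` the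
non-trivial automorphism of `E/F` (`hcc : c² = 1`).  A HECKE CHARACTER of `E`: continuous (`χ` is, `IsAutomorphicOneChar`), and
trivial on `Eˣ` because `(k)_f / (k)_fᶜ = (k/kᶜ)_f` is the diagonal image of the rational norm-one element `k/kᶜ ∈ E¹`, on which
`χ` is trivial (`IsAutomorphicOneChar`, second clause).  Its infinite component is TRIVIAL (`checkOfChi_infiniteIdeles`,
`hasInfinityType_zero_checkOfChi`).  The place-by-place `χ̌_w(ϖ_w)` bookkeeping at a place `w` split over `F` (the local
`S.check χ` of ★ `LemD1AsPrinted`) is left to the S4 typing file (TODO(valueAtUniformizer_checkOfChi)).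
[cite: Liu2021, App. D §D.1 (l. 5224); Lemma D.1 (4) (l. 5235); Thm. D.6 (l. 5441); Thm. D.6 (1) proof (l. 5624, 5630)] -/
def _root_.Literature.NumberTheory.GaloisRepresentations.HeckeCharacter.checkOfChi (hcc : c * c = 1) (χ : Chi F E c) :
    HeckeCharacter E where
  toContinuousMonoidHom :=
    { (χ : finAdelicOne F E c →* ℂˣ).comp ((finAdelicCheck F E c hcc).comp (idelicFinPart E)) with
      continuous_toFun :=
        χ.2.1.comp ((continuous_finAdelicCheck F E c hcc).comp (continuous_idelicFinPart E)) }
  map_principal' := by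
    rintro x ⟨k, rfl⟩
    -- `(k)_f / (k)_fᶜ` is the diagonal image of the rational norm-one element `k / kᶜ`
    have hck : ((c : E ≃ₐ[F] E) (k : E)) ≠ 0 := by
      rw [map_ne_zero]; exact k.ne_zero
    let k' : Eˣ := k / Units.mk0 _ hck
    have ha : idelicFinPart E (Units.map (algebraMap E (AdeleRing (𝓞 E) E)).toMonoidHom k) =
        Units.map (algebraMap E (FiniteAdeleRing (𝓞 E) E)).toMonoidHom k := Units.ext rfl
    have hb : Units.map (conjFiniteAdele F E c).toMonoidHom (Units.map (algebraMap E (FiniteAdeleRing (𝓞 E) E)).toMonoidHom k) =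
        Units.map (algebraMap E (FiniteAdeleRing (𝓞 E) E)).toMonoidHom (Units.mk0 _ hck) :=
      Units.ext (by
        change conjFiniteAdele F E c (algebraMap E (FiniteAdeleRing (𝓞 E) E) (k : E)) =
          algebraMap E (FiniteAdeleRing (𝓞 E) E) (c (k : E))
        rw [conjFiniteAdele_apply, FiniteAdeleRing.smul_algebraMap]
        rfl)
    have hval : ((finAdelicCheck F E c hcc (idelicFinPart E (Units.map (algebraMap E (AdeleRing (𝓞 E) E)).toMonoidHom k)) :
        finAdelicOne F E c) : (FiniteAdeleRing (𝓞 E) E)ˣ) = Units.map (algebraMap E (FiniteAdeleRing (𝓞 E) E)).toMonoidHom k' := by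
      rw [coe_finAdelicCheck, ha, hb, ← map_div]
    have hmem : Units.map (algebraMap E (FiniteAdeleRing (𝓞 E) E)).toMonoidHom k' ∈ finAdelicOne F E c :=
      hval ▸ (finAdelicCheck F E c hcc (idelicFinPart E (Units.map (algebraMap E (AdeleRing (𝓞 E) E)).toMonoidHom k))).2
    have key := χ.2.2 k' hmem
    change χ.1 (finAdelicCheck F E c hcc (idelicFinPart E _)) = 1
    rw [← key]
    congr 1
    exact Subtype.ext hval

namespace CheckOfChi

variable (hcc : c * c = 1) (χ : Chi F E c)

/-- Unfolding: `χ̌(x) = χ(x_f / x_fᶜ)`. [cite: Liu2021, App. D §D.1 (l. 5224)] -/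
theorem checkOfChi_apply (x : ideleGroup E) :
    HeckeCharacter.checkOfChi hcc χ x = (χ : finAdelicOne F E c →* ℂˣ) (finAdelicCheck F E c hcc (idelicFinPart E x)) := rfl

/-- **`χ̌_∞ = 1`**: `χ̌` is trivial on the infinite idèles `(x_∞, 1)` (their finite part is `1`). [cite: Liu2021, App. D §D.1 (l. 5224)] -/
theorem checkOfChi_infiniteIdeles (x : (InfiniteAdeleRing E)ˣ) :
    HeckeCharacter.checkOfChi hcc χ (infiniteIdeles E x) = 1 := by
  rw [checkOfChi_apply]
  have h : idelicFinPart E (infiniteIdeles E x) = 1 := Units.ext rfl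
  rw [h, map_one, map_one]

/-- **`χ̌` has infinity type `(0, 0)`** (it is trivial at infinity): the `HasInfinityType` clause with `U = univ`.
[cite: Liu2021, App. D §D.1 (l. 5224)] [cite: SerreAbelianLadic1968, Ch. II §2.4] -/
theorem hasInfinityType_zero_checkOfChi :
    (HeckeCharacter.checkOfChi hcc χ).HasInfinityType (fun _ => 0) (fun _ => 0) := by
  refine ⟨Set.univ, Filter.univ_mem, fun x _ => ?_⟩
  rw [checkOfChi_infiniteIdeles, Units.val_one, HeckeCharacter.archFactor_apply]
  simp

/-- `χ̌` on the LOCAL UNITS `ι_w : E_wˣ → 𝕀_E` at a finite place `w` of `E`: `χ̌(ι_w u) = χ(single_w(u) / single_w(u)ᶜ)`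
(the finite part of `ι_w u` is the finite idèle `single_w(u)`; definitional). [cite: Liu2021, App. D §D.1 (l. 5224)] -/
theorem checkOfChi_localUnits (w : HeightOneSpectrum (𝓞 E)) (u : (w.adicCompletion E)ˣ) :
    HeckeCharacter.checkOfChi hcc χ (localUnits w u) =
      (χ : finAdelicOne F E c →* ℂˣ) (finAdelicCheck F E c hcc (Units.map (finiteAdeleSingle w) u)) := rfl

/-- The LOCAL COMPONENT `χ̌_w = χ̌ ∘ ι_w` of `χ̌` at a finite place `w` of `E`, unfolded. [cite: Liu2021, App. D §D.1 (l. 5224)] -/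
theorem localComponent_checkOfChi_apply (w : HeightOneSpectrum (𝓞 E)) (u : (w.adicCompletion E)ˣ) :
    (HeckeCharacter.checkOfChi hcc χ).localComponent w u =
      (χ : finAdelicOne F E c →* ℂˣ) (finAdelicCheck F E c hcc (Units.map (finiteAdeleSingle w) u)) := rfl

/-- `χ̌` of the trivial character is trivial. [cite: Liu2021, App. D §D.1 (l. 5224)] -/
theorem checkOfChi_one : HeckeCharacter.checkOfChi hcc (default : Chi F E c) = 1 := by
  ext x
  rw [checkOfChi_apply]
  rfl

/-- `χ̌` is multiplicative in `χ` (pointwise product of automorphic characters). [cite: Liu2021, App. D §D.1 (l. 5224)] -/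
theorem checkOfChi_apply_mul (χ₁ χ₂ : Chi F E c) (h : IsAutomorphicOneChar F E c (χ₁.1 * χ₂.1)) (x : ideleGroup E) :
    HeckeCharacter.checkOfChi hcc ⟨χ₁.1 * χ₂.1, h⟩ x =
      HeckeCharacter.checkOfChi hcc χ₁ x * HeckeCharacter.checkOfChi hcc χ₂ x := by
  rw [checkOfChi_apply, checkOfChi_apply, checkOfChi_apply]
  rfl

end CheckOfChi

end Literature.NumberTheory.Automorphic.Liu2021

end
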